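import Summits.ABC.IUTFork.DAGC312k
import Summits.ABC.IUTFork.DAGL6b
import Summits.ABC.IUTFork.DAGL6d
import Summits.ABC.IUTFork.DAGL6p
import Summits.ABC.IUTFork.DAGL6q
import Summits.ABC.IUTFork.DAGL6r
import Summits.ABC.IUTFork.DAGL6s
import Summits.ABC.IUTFork.DAGL6v
import Summits.ABC.IUTFork.DAGL6w
import Summits.ABC.IUTFork.DAGL6x
import Summits.ABC.IUTFork.DAGL6zb
import Summits.ABC.IUTFork.DAGUa
import Summits.ABC.IUTFork.DAGUb

/-!
# L6 LAYER CERTIFICATE, part A — the [IUTchII] members of the Cor 3.12 cone, packaged BY NAME over the kernel DAG index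

abc-iut cell, director-abc (C2) «Conditional/Layer<k>OfS»; spec plan/L6/CERT-L6.md v0 (abc-iut-L6-lead gen 3); conventions K1–K5 = §F v1.19n,
R-def (b) + split count = §F v1.19s; STATUS SOURCE of this version = plan/L6/NODES.md v3.4ag via abc-iut-L6-t8's MAP generator
(`CERT-L6-MAP-v4.4-partA.tsv`); holder abc-iut-w5-d012 (gen 4) on abc-iut-w5-d112's draft; R abc-iut-w5-d109, R2 abc-iut-w5-d223. cert-A v8, 119 rows.

THIS FILE PROVES NOTHING NEW AND ASSERTS NOTHING: every conjunct is an index Prop `N_<id>` / index sub-row Prop BY NAME and every witness is an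
index `_holds`/`_part` term BY NAME — no tactic proof of content, no restatement, no new `def … : Prop` fact, no `instance`, no schema ∀-closed.

APPEND-ONLY DESIGN (the gate forbids changing a landed definition body in place): the three defs `Layer6DischargedA` / `Layer6ResidualA` /
`Layer6ConeA` are the KERNEL PACKAGING OF RECORD, frozen at cert-A v5 (p428300, NODES v3.4ac): `Layer6DischargedA` = 47 nodes / 67 conjuncts,
`Layer6ResidualA` = 36 conjuncts (kernel-inhabited: `layer6ResidualA_inhabited`, Conditional/Layer6OfSaWitness p429165). Each later NODES fold
changes ONLY (i) the COUNT LINE below, (ii) the per-row comment tags, and (iii) APPENDS one theorem `layer6DischargedA_<fold>_holds` naming the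
kernel witnesses of the rows that became NODES-discharged in that fold and were not yet inside `Layer6DischargedA` (theorems are append-safe).
Rows NODES-discharged after v5 that sit inside the frozen `Layer6ResidualA`: Cor1.11, Cor1.12(i), Cor4.5(iii), Prop1.2(i), Prop1.2(ii), Prop1.4, Prop1.5(i) (tagged; witnessed in the fold theorem).
CONTINUATION (line budget of this file reached at NODES v3.4ag): from NODES v3.4ah on, the LIVE COUNT LINE and all further fold theorems
`layer6DischargedA_<fold>_holds` are in the PROOF-ONLY companion `Summits/ABC/IUTFork/Conditional/Layer6OfSaFolds.lean` (imports this file);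
the COUNT LINE below is the one @ NODES v3.4ag and is SUPERSEDED by that file when newer. This file is frozen apart from that.

COUNT LINE @ NODES v3.4ag (§F v1.19s split «nodes = d_nodes + d_idx + r + d_data + f + not-indexed»; R-def (b)):
119 = d_nodes 43 (NODES-discharged = lead-certified print coverage: 16 Corollary + 7 Definition + 7 Example + 13 Proposition) + d_idx 13
(index-discharged: NODES-landed 8 Definition + 5 Example nodes whose index Prop carries a kernel witness — dag's discharged-at-landing reading;
print coverage NOT lead-certified) + r 29 (Residual: NODES-landed claim nodes) + d_data 30 (K4: index alias of a definition / structure — 17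
constructed objects + 13 SLOT-ONLY `…Statements` interfaces; LISTED below, name-checked by `example`; 13 of them NODES-discharged) + f 3 (K3
schemas, listed) + not-indexed 1 (K5). 43 + 13 + 29 + 30 + 3 + 1 = 119. L6 SCOREBOARD (lead, print-coverage) = d_nodes; d_idx = kernel theorems of
index Props whose print coverage the lead has not yet certified.
KERNEL NOTE (honest): every index claim Prop is a `StatementOf` conjunction of LANDED theorems, so each residual conjunct is kernel-inhabited;
«discharged vs residual» is the NODES row STATUS, not kernel provability — r is a documented bookkeeping count, no residual conjunct is an open
kernel obligation.
FACTS CONSUMED (spec §1; FACT-LIST rows NAMED AS HYPOTHESES inside conjunct statements — abc-iut-w5-d109's R memo; vocabulary predicates omitted;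
keyed to the NODES v3.4ag placement):
Discharged — conditional F-0536, F-0542, F-0543, F-0621, F-0624, F-0625, F-0738; fact-open F-0591; model-witness F-0665; proved F-0539; Residual —
conditional F-0417, F-0536, F-0542, F-0543, F-0544, F-0545, F-0621, F-0738, F-1949, F-2633, F-2779; fact-open F-0418, F-0591, F-0609, F-0620,
F-2781, F-2782, F-2783; proved F-0539; witness-candidate F-2780.
These F-rows (where not PROVED) and S at the Cor 3.12 node are the OPEN named inputs of the [IUTchII] slice. S consumed at L6: NO.
HONEST FRAMING: typed ≠ proved; indexed ≠ endorsed; kernel-witnessed ≠ lead-discharged; nothing here asserts that abc is proved or refuted or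
takes a side on [IUTchIII] Cor. 3.12. [claim: Mochizuki2012, status: disputed]

d_data @ v3.4ag — K4 «constructed (data)» [data] / SLOT-ONLY statement interfaces [slot-only] (index alias := @decl (p-id); NODES status):
Cor2.5(iii) [slot-only] @Cor25Cor26Statements (p404618); NODES=landed · Cor2.6(i) [data] @unitsModTorsionOf (p404618); NODES=landed · Cor4.10(v)
[data] @HodgeTheaterStrips (p404606); NODES=landed · Cor4.5(i) [slot-only] @Cor45Statements (p404130); NODES=discharged:p404130 · Cor4.6(i)
[slot-only] @Cor46Statements (p404130); NODES=discharged:p411824 · Cor4.7(i) [slot-only] @Cor47Statements (p404130); NODES=landed · Cor4.7(ii)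
[slot-only] @Cor47Statements (p404130); NODES=landed · Cor4.7(iii) [slot-only] @Cor47Statements (p404130); NODES=landed · Cor4.8(i) [slot-only]
@Cor48Statements (p404130); NODES=landed · Cor4.8(ii) [slot-only] @Cor48Statements (p404130); NODES=landed · Cor4.8(iii) [slot-only] @Cor48Statements
(p404130); NODES=landed · Def2.7(i) [data] @MonoThetaProjData.exteriorCyclotome (p404618); NODES=landed · Ex1.7(i) [data] @RadialEnvironment
(p404042); NODES=landed · Ex1.8(iv) [data] @AbsTopMonoids.Omu (p406303); NODES=discharged:p406303 · Ex1.8(ix) [data] @AbsTopMonoids.unitsInvariants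
(p406303); NODES=discharged:p407495 · Ex1.8(v) [data] @pairEnvironment (p406303); NODES=landed · Ex1.8(vi) [data] @pairEnvironment (p406303);
NODES=discharged:p406303 · Ex1.8(vii) [data] @AbsTopMonoids.Ogp (p406303); NODES=discharged:p407495 · Ex1.8(viii) [data] @pairEnvironment (p406303);
NODES=discharged:p406303 · Ex3.2(ii) [data] @TemperedThetaMonoids.TemperedFrobenioidThetaData (p404874); NODES=landed · Prop3.3(ii) [data]
@GoodPrimeKummer.cyclotomeMapOf (p404874); NODES=landed · Prop4.1(i) [data] @ConstantMonoidDatum (p404520); NODES=landed · Prop4.1(ii) [data]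
@LogRealDatum (p404520); NODES=discharged:p404520 · Prop4.2(i) [slot-only] @Prop42Statements (p419040); NODES=discharged:p419040 · Prop4.3(i) [data]
@ConstantMonoidDatum.ofArch (p404520); NODES=landed · Prop4.3(iii) [data] @diagonalSubmonoid (p404520); NODES=landed · Prop4.4(i) [slot-only]
@Prop44Statements (p416766); NODES=discharged:p416766 · Prop4.4(ii) [data] @PointedHalfLine (p416766); NODES=discharged:p416766 · Prop4.4(iii)
[slot-only] @Prop44Statements (p415883); NODES=discharged:p415883 · Prop4.4(iv) [slot-only] @Prop44Statements (p415883); NODES=discharged:p415883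
K4-exception nodes (data-form index alias, NODES-discharged through closed index sub-rows), ALSO listed as constructed:
* IUTchII:Cor3.5(i) — N_IUTchII_Cor3_5_i := @Cor35Statements (p411833) · NODES discharged:p411833
* IUTchII:Cor3.6(i) — N_IUTchII_Cor3_6_i := @piIso (p411833) · NODES discharged:p411833
* IUTchII:Cor4.5(ii) — N_IUTchII_Cor4_5_ii := @Remark45Statements (p404130) · NODES discharged:p404520
* IUTchII:Cor4.6(iv) — N_IUTchII_Cor4_6_iv := @Cor46Statements (p404130) · NODES discharged:p420309
* IUTchII:Cor4.6(v) — N_IUTchII_Cor4_6_v := @Cor46Statements (p414292) · NODES discharged:p414292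
* IUTchII:Prop1.5(iii) — N_IUTchII_Prop1_5_iii := @MonoThetaProjSystem.extCycLim (p415224) · NODES discharged:p415224

f — K3 FLAGGED SCHEMAS (index alias := @<Prop-valued predicate over binders>; blind ∀-closure refused; no lead-named closed instance form):
* IUTchII:Cor2.8(ii) — `N_IUTchII_Cor2_8_ii` := @ThetaValueOrbits.Cor28ii_functorialAlgorithm (8 binders → Prop; p404347; NODES landed) —
  `cor28ii_canonical` (ThetaValueOrbitsProofs) exists in the tree but is not a lead-named instance form
* IUTchII:Cor2.8(iii) — `N_IUTchII_Cor2_8_iii` := @ThetaValueOrbits.Cor28iii_splitting (11 binders → Prop; p404347; NODES landed) —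
  `cor28iii_of_transport`, `cor28iii_unique` (ThetaValueOrbitsProofs) exist in the tree but are not lead-named instance forms
* IUTchII:Prop1.5(iv) — `N_IUTchII_Prop1_5_iv` := @Prop15_iv_compatible (5 binders → Prop; p407497; NODES landed) —
  the equation `θ_Kum = θ_env` over [EtTh] §5 data not constructible here (TODO-merge abc-iut-L2-t4)

not-indexed, K5:
* IUTchII:Def2.3(v) — NODES landed; typed decls BY NAME: data `Literature.IUT.HodgeArakelov.FlTorsorStructure`, schema
  `Literature.IUT.HodgeArakelov.Def23_structures` (p407174 LabelClassesOfCusps; characterisation `def23_structures_iff_isos` p420904) — no conjunct.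

FACT-LIST schema rows of the part-A statement modules, per node (MAP column «FACT_schemas_of_node»; information only, never ∀-closed):
Cor1.10: F-2780:Cor110cNatural[witness-candidate] · Cor2.4(i): F-1949:Cor24_i[conditional]; F-2679:Cor24_i'[conditional] · Cor4.10(iv):
F-2065:UnitMuCoric[conditional] · Def1.1(i): F-0662:MuConjugate[predicate] · Def1.1(ii): F-0526:CyclotomicRigidity[conditional];
F-2779:MonoThetaConventional[conditional] · Def2.3(i): F-1950:Def23_i_indices[predicate]; F-2734:SubgraphDictionary[fact-open] · Def2.3(ii):
F-0483:Def23_ii'[predicate]; F-1951:Def23_ii[predicate] · Def4.9(i): F-2062:KummerTimesUnique[conditional] · Ex1.8(ii): F-0415:IsTMPair[predicate];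
F-0416:IsTMPairMTM[predicate]; F-2564:ContinuityLaws[predicate] · Ex1.9(iii): F-0421:quotientFunctor_not_full[predicate] · Prop1.2(i):
F-0663:Prop12_i_indeterminacy[model-witness] · Prop1.3(i): F-0420:Prop13_i_ii[conditional] · Prop1.3(iii): F-0664:Prop13_iii[conditional] ·
Prop1.5(i): F-0665:Prop15_i[model-witness]; F-0670:Prop15_i'[conditional] · Prop1.5(ii): F-0666:Prop15_ii_iii[predicate];
F-0668:transitionsAreIsos[predicate] · Prop1.5(iv): F-0667:Prop15_iv_compatible[predicate] · Prop2.2(i): F-0596:Prop22_i[model-witness];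
F-1781:Prop22_i[proved]; F-1782:SubgraphReference.GroupTheoretic[predicate] · Prop2.2(ii): F-0597:Prop22_ii[model-witness];
F-0661:Prop22_ii'[conditional]; F-0675:Prop22_ii[universal-closure REFUTED / schema; instance forms open or model-witnessed] · Prop3.1(i):
F-2064:IsConjStable[predicate]; F-2566:IsSplittingUpToTorsion[predicate]; F-2567:Prop31Statements[conditional] · Prop4.2(ii): F-2061:IsoUnique[proved]
· Prop4.4(i): F-1044:Prop44i[universal-closure REFUTED / schema; instance forms open or model-witnessed]
-/

noncomputable section

namespace Summit.ABC.IUTFork.Conditional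

open Summit.ABC.IUTFork.DAG

universe u₁ u₂ u₃ u₄ u₅ u₆ u₇ u₈ u₉

/-- **DISCHARGED [IUTchII] cone nodes — kernel packaging of record (frozen at cert-A v5 / NODES v3.4ac: 47 nodes, 67 conjuncts)**;
per-row tags = NODES v3.4ag. Per node its index Prop BY NAME and, where the index attaches closed discharge SUB-ROWS with `_holds`, those sub-row
Props BY NAME; universe-instantiated with the index's level names. [claim: Mochizuki2012, status: disputed] -/
def Layer6DischargedA : Prop :=
  -- IUTchII:Cor1.12(ii) [Corollary] · NODES-discharged (p411909)
  N_IUTchII_Cor1_12_ii.{u₁}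
  ∧ N_IUTchII_Cor1_12_ii_r13.{u₁}
  -- IUTchII:Cor3.5(i) [Corollary] · NODES-discharged (p411833) · K4-exception via sub-rows
  ∧ N_IUTchII_Cor3_5_i_r4.{u₁}
  ∧ N_IUTchII_Cor3_5_i_r5.{u₁, u₂}
  -- IUTchII:Cor3.5(ii) [Corollary] · NODES-discharged (p411833)
  ∧ N_IUTchII_Cor3_5_ii.{u₁, u₂}
  -- IUTchII:Cor3.5(iii) [Corollary] · NODES-discharged (p411833)
  ∧ N_IUTchII_Cor3_5_iii.{u₁, u₂}
  ∧ N_IUTchII_Cor3_5_iii_r14.{u₁, u₂, u₃}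
  -- IUTchII:Cor3.6(i) [Corollary] · NODES-discharged (p411833) · K4-exception via sub-rows
  ∧ N_IUTchII_Cor3_6_i_r4.{u₁}
  ∧ N_IUTchII_Cor3_6_i_r5.{u₁, u₂, u₃}
  -- IUTchII:Cor3.6(ii) [Corollary] · NODES-discharged (p414485)
  ∧ N_IUTchII_Cor3_6_ii.{u₁, u₂, u₃}
  ∧ N_IUTchII_Cor3_6_ii_r6.{u₁, u₂, u₃}
  ∧ N_IUTchII_Cor3_6_ii_r9.{u₁, u₂, u₃, u₄, u₅}
  ∧ N_IUTchII_Cor3_6_ii_r10.{u₁, u₂, u₃, u₄, u₅}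
  ∧ N_IUTchII_Cor3_6_ii_r12.{u₁, u₂, u₃}
  ∧ N_IUTchII_Cor3_6_ii_r7.{u₁, u₂, u₃}
  -- IUTchII:Cor3.6(iii) [Corollary] · NODES-discharged (p414485)
  ∧ N_IUTchII_Cor3_6_iii.{u₁, u₂, u₃}
  ∧ N_IUTchII_Cor3_6_iii_r15.{u₁, u₂}
  ∧ N_IUTchII_Cor3_6_iii_r16.{u₁, u₂, u₃}
  ∧ N_IUTchII_Cor3_6_iii_r17.{u₁, u₂, u₃, u₄, u₅}
  ∧ N_IUTchII_Cor3_6_iii_r19.{u₁, u₂, u₃}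
  ∧ N_IUTchII_Cor3_6_iii_r14.{u₁, u₂, u₃}
  ∧ N_IUTchII_Cor3_6_iii_r18.{u₁, u₂, u₃}
  -- IUTchII:Cor4.10(iv) [Corollary] · NODES-discharged (p406872)
  ∧ N_IUTchII_Cor4_10_iv.{u₁, u₂, u₃, u₄, u₅, u₆, u₇, u₈}
  -- IUTchII:Cor4.6(ii) [Corollary] · NODES-discharged (p414292)
  ∧ N_IUTchII_Cor4_6_ii.{u₁, u₂, u₃, u₄}
  -- IUTchII:Cor4.6(iii) [Corollary] · NODES-discharged (p414292)
  ∧ N_IUTchII_Cor4_6_iii.{u₁, u₂}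
  ∧ N_IUTchII_Cor4_6_iii_r10.{u₁, u₂}
  -- IUTchII:Cor4.6(v) [Corollary] · NODES-discharged (p414292) · K4-exception via sub-rows
  ∧ N_IUTchII_Cor4_6_v_r15.{u₁, u₂}
  ∧ N_IUTchII_Cor4_6_v_r16.{u₁, u₂, u₃}
  -- IUTchII:Def1.1(i) [Definition] · index-discharged (kernel witness `_holds`); print-coverage not lead-certified (NODES: landed)
  ∧ N_IUTchII_Def1_1_i.{u₁}
  -- IUTchII:Def1.1(ii) [Definition] · index-discharged (kernel witness `_holds`); print-coverage not lead-certified (NODES: landed)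
  ∧ N_IUTchII_Def1_1_ii.{u₁}
  -- IUTchII:Def2.3(i) [Definition] · index-discharged (kernel witness `_holds`); print-coverage not lead-certified (NODES: landed)
  ∧ N_IUTchII_Def2_3_i.{u₁}
  -- IUTchII:Def2.3(ii) [Definition] · index-discharged (kernel witness `_holds`); print-coverage not lead-certified (NODES: landed)
  ∧ N_IUTchII_Def2_3_ii.{u₁}
  -- IUTchII:Def2.3(iii) [Definition] · index-discharged (kernel witness `_holds`); print-coverage not lead-certified (NODES: landed)
  ∧ N_IUTchII_Def2_3_iii.{u₁}
  -- IUTchII:Def2.3(iv) [Definition] · index-discharged (kernel witness `_holds`); print-coverage not lead-certified (NODES: landed)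
  ∧ N_IUTchII_Def2_3_iv.{u₁}
  -- IUTchII:Def2.7(ii) [Definition] · index-discharged (kernel witness `_holds`); print-coverage not lead-certified (NODES: landed)
  ∧ N_IUTchII_Def2_7_ii.{u₁, u₂}
  -- IUTchII:Def4.9(i) [Definition] · index-discharged (kernel witness `_holds`); print-coverage not lead-certified (NODES: landed)
  ∧ N_IUTchII_Def4_9_i.{u₁, u₂}
  -- IUTchII:Def4.9(ii) [Definition] · NODES-discharged (p405008) since v3.4ag
  ∧ N_IUTchII_Def4_9_ii.{u₁, u₂, u₃}
  -- IUTchII:Def4.9(iii) [Definition] · NODES-discharged (p405008) since v3.4ag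
  ∧ N_IUTchII_Def4_9_iii.{u₁, u₂}
  -- IUTchII:Def4.9(iv) [Definition] · NODES-discharged (p405008) since v3.4ag
  ∧ N_IUTchII_Def4_9_iv.{u₁, u₂, u₃}
  -- IUTchII:Def4.9(v) [Definition] · NODES-discharged (p405008) since v3.4ag
  ∧ N_IUTchII_Def4_9_v.{u₁}
  -- IUTchII:Def4.9(vi) [Definition] · NODES-discharged (p405008) since v3.4ag
  ∧ N_IUTchII_Def4_9_vi.{u₁}
  -- IUTchII:Def4.9(vii) [Definition] · NODES-discharged (p405008) since v3.4ag
  ∧ N_IUTchII_Def4_9_vii.{u₁, u₂, u₃}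
  -- IUTchII:Def4.9(viii) [Definition] · NODES-discharged (p405008) since v3.4ag
  ∧ N_IUTchII_Def4_9_viii.{u₁, u₂, u₃}
  -- IUTchII:Ex1.7(ii) [Example] · index-discharged (kernel witness `_part`); print-coverage not lead-certified (NODES: landed)
  ∧ N_IUTchII_Ex1_7_ii.{u₁, u₂}
  -- IUTchII:Ex1.7(iii) [Example] · index-discharged (kernel witness `_part`); print-coverage not lead-certified (NODES: landed)
  ∧ N_IUTchII_Ex1_7_iii.{u₁, u₂}
  -- IUTchII:Ex1.7(iv) [Example] · index-discharged (kernel witness `_part`); print-coverage not lead-certified (NODES: landed)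
  ∧ N_IUTchII_Ex1_7_iv.{u₁, u₂}
  -- IUTchII:Ex1.7(v) [Example] · index-discharged (kernel witness `_part`); print-coverage not lead-certified (NODES: landed)
  ∧ N_IUTchII_Ex1_7_v.{u₁, u₂}
  -- IUTchII:Ex1.8(i) [Example] · NODES-discharged (p406303) since v3.4ag
  ∧ N_IUTchII_Ex1_8_i.{u₁}
  -- IUTchII:Ex1.8(ii) [Example] · NODES-discharged (p406303) since v3.4ag
  ∧ N_IUTchII_Ex1_8_ii.{u₁}
  -- IUTchII:Ex1.8(iii) [Example] · NODES-discharged (p406303) since v3.4ag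
  ∧ N_IUTchII_Ex1_8_iii.{u₁}
  -- IUTchII:Ex1.9(i) [Example] · NODES-discharged (p406616) since v3.4ag
  ∧ N_IUTchII_Ex1_9_i.{u₁, u₂, u₃, u₄}
  -- IUTchII:Ex1.9(ii) [Example] · NODES-discharged (p406616) since v3.4ag
  ∧ N_IUTchII_Ex1_9_ii.{u₁, u₂, u₃}
  -- IUTchII:Ex1.9(iii) [Example] · NODES-discharged (p406616) since v3.4ag
  ∧ N_IUTchII_Ex1_9_iii.{u₁, u₂, u₃}
  -- IUTchII:Ex1.9(iv) [Example] · NODES-discharged (p406616) since v3.4ag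
  ∧ N_IUTchII_Ex1_9_iv.{u₁}
  -- IUTchII:Ex3.2(i) [Example] · index-discharged (kernel witness `_part`); print-coverage not lead-certified (NODES: landed)
  ∧ N_IUTchII_Ex3_2_i.{u₁}
  -- IUTchII:Prop1.3(ii) [Proposition] · NODES-discharged (p411824)
  ∧ N_IUTchII_Prop1_3_ii.{u₁}
  -- IUTchII:Prop1.5(ii) [Proposition] · NODES-discharged (p414240)
  ∧ N_IUTchII_Prop1_5_ii.{u₁}
  ∧ N_IUTchII_Prop1_5_ii_L02
  ∧ N_IUTchII_Prop1_5_ii_L03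
  -- IUTchII:Prop1.5(iii) [Proposition] · NODES-discharged (p415224) · K4-exception via sub-rows
  ∧ N_IUTchII_Prop1_5_iii_L01
  ∧ N_IUTchII_Prop1_5_iii_L04
  -- IUTchII:Prop4.1(iv) [Proposition] · NODES-discharged (p404520)
  ∧ N_IUTchII_Prop4_1_iv.{u₁}
  -- IUTchII:Prop4.2(ii) [Proposition] · NODES-discharged (p419040)
  ∧ N_IUTchII_Prop4_2_ii
  -- IUTchII:Prop4.2(iii) [Proposition] · NODES-discharged (p415883)
  ∧ N_IUTchII_Prop4_2_iii.{u₁, u₂, u₃}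
  -- IUTchII:Prop4.2(iv) [Proposition] · NODES-discharged (p416922)
  ∧ N_IUTchII_Prop4_2_iv.{u₁}
  -- IUTchII:Prop4.3(ii) [Proposition] · NODES-discharged (p418389)
  ∧ N_IUTchII_Prop4_3_ii.{u₁}
  -- IUTchII:Prop4.3(iv) [Proposition] · NODES-discharged (p404520)
  ∧ N_IUTchII_Prop4_3_iv.{u₁}

/-- The discharged conjunction of record HOLDS — a term of 67 index witness NAMES only (`_holds`/`_part`). Proves nothing new.
[claim: Mochizuki2012, status: disputed] -/
theorem layer6DischargedA_holds : Layer6DischargedA.{u₁, u₂, u₃, u₄, u₅, u₆, u₇, u₈} :=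
  ⟨N_IUTchII_Cor1_12_ii_holds, N_IUTchII_Cor1_12_ii_r13_holds, N_IUTchII_Cor3_5_i_r4_holds,
    N_IUTchII_Cor3_5_i_r5_holds, N_IUTchII_Cor3_5_ii_holds, N_IUTchII_Cor3_5_iii_holds,
    N_IUTchII_Cor3_5_iii_r14_holds, N_IUTchII_Cor3_6_i_r4_holds, N_IUTchII_Cor3_6_i_r5_holds,
    N_IUTchII_Cor3_6_ii_holds, N_IUTchII_Cor3_6_ii_r6_holds, N_IUTchII_Cor3_6_ii_r9_holds,
    N_IUTchII_Cor3_6_ii_r10_holds, N_IUTchII_Cor3_6_ii_r12_holds, N_IUTchII_Cor3_6_ii_r7_holds,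
    N_IUTchII_Cor3_6_iii_holds, N_IUTchII_Cor3_6_iii_r15_holds, N_IUTchII_Cor3_6_iii_r16_holds,
    N_IUTchII_Cor3_6_iii_r17_holds, N_IUTchII_Cor3_6_iii_r19_holds, N_IUTchII_Cor3_6_iii_r14_holds,
    N_IUTchII_Cor3_6_iii_r18_holds, N_IUTchII_Cor4_10_iv_holds, N_IUTchII_Cor4_6_ii_holds,
    N_IUTchII_Cor4_6_iii_holds, N_IUTchII_Cor4_6_iii_r10_holds, N_IUTchII_Cor4_6_v_r15_holds,
    N_IUTchII_Cor4_6_v_r16_holds, N_IUTchII_Def1_1_i_holds, N_IUTchII_Def1_1_ii_holds,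
    N_IUTchII_Def2_3_i_holds, N_IUTchII_Def2_3_ii_holds, N_IUTchII_Def2_3_iii_holds,
    N_IUTchII_Def2_3_iv_holds, N_IUTchII_Def2_7_ii_holds, N_IUTchII_Def4_9_i_holds,
    N_IUTchII_Def4_9_ii_holds, N_IUTchII_Def4_9_iii_holds, N_IUTchII_Def4_9_iv_holds,
    N_IUTchII_Def4_9_v_holds, N_IUTchII_Def4_9_vi_holds, N_IUTchII_Def4_9_vii_holds,
    N_IUTchII_Def4_9_viii_holds, N_IUTchII_Ex1_7_ii_part, N_IUTchII_Ex1_7_iii_part,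
    N_IUTchII_Ex1_7_iv_part, N_IUTchII_Ex1_7_v_part, N_IUTchII_Ex1_8_i_part,
    N_IUTchII_Ex1_8_ii_part, N_IUTchII_Ex1_8_iii_part, N_IUTchII_Ex1_9_i_part,
    N_IUTchII_Ex1_9_ii_part, N_IUTchII_Ex1_9_iii_part, N_IUTchII_Ex1_9_iv_part,
    N_IUTchII_Ex3_2_i_part, N_IUTchII_Prop1_3_ii_holds, N_IUTchII_Prop1_5_ii_holds,
    N_IUTchII_Prop1_5_ii_L02_holds, N_IUTchII_Prop1_5_ii_L03_holds, N_IUTchII_Prop1_5_iii_L01_holds,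
    N_IUTchII_Prop1_5_iii_L04_holds, N_IUTchII_Prop4_1_iv_part, N_IUTchII_Prop4_2_ii_holds,
    N_IUTchII_Prop4_2_iii_holds, N_IUTchII_Prop4_2_iv_holds, N_IUTchII_Prop4_3_ii_holds,
    N_IUTchII_Prop4_3_iv_holds⟩

/-- **RESIDUAL [IUTchII] cone nodes — kernel packaging of record (frozen at cert-A v5: 36 bare index Props of the NODES-v3.4ac-landed claim
nodes)**; per-row tags = NODES v3.4ag (7 of these rows are NODES-discharged since — their witnesses sit in the fold theorem(s) below; the
definition body cannot move under the append-only rule). NO theorem of print content is offered; the conjunction itself is kernel-inhabited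
(`layer6ResidualA_inhabited`, Layer6OfSaWitness). r in the COUNT LINE is the NODES count, not this body's length. [claim: Mochizuki2012, status: disputed] -/
def Layer6ResidualA : Prop :=
  N_IUTchII_Cor1_10.{u₁} -- IUTchII:Cor1.10 · DAGL6q
  ∧ N_IUTchII_Cor1_11.{u₁} -- IUTchII:Cor1.11 · DAGC312k · NODES-discharged since v3.4ag (p409065); kernel witness in `layer6DischargedA_v3_4ag_holds`
  ∧ N_IUTchII_Cor1_12_i.{u₁} -- IUTchII:Cor1.12(i) · DAGL6q · NODES-discharged since v3.4ag (p410537); kernel witness in `layer6DischargedA_v3_4ag_holds`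
  ∧ N_IUTchII_Cor1_12_iii.{u₁} -- IUTchII:Cor1.12(iii) · DAGL6q
  ∧ N_IUTchII_Cor2_4_i.{u₁, u₂} -- IUTchII:Cor2.4(i) · DAGL6r
  ∧ N_IUTchII_Cor2_4_ii.{u₁} -- IUTchII:Cor2.4(ii) · DAGL6r
  ∧ N_IUTchII_Cor2_4_iii.{u₁} -- IUTchII:Cor2.4(iii) · DAGL6r
  ∧ N_IUTchII_Cor2_5_i.{u₁} -- IUTchII:Cor2.5(i) · DAGL6d
  ∧ N_IUTchII_Cor2_5_ii.{u₁} -- IUTchII:Cor2.5(ii) · DAGL6d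
  ∧ N_IUTchII_Cor2_6_ii.{u₁} -- IUTchII:Cor2.6(ii) · DAGL6d
  ∧ N_IUTchII_Cor2_8_i.{u₁, u₂} -- IUTchII:Cor2.8(i) · DAGL6d
  ∧ N_IUTchII_Cor4_10_i.{u₁, u₂, u₃, u₄, u₅, u₆, u₇, u₈} -- IUTchII:Cor4.10(i) · DAGL6d
  ∧ N_IUTchII_Cor4_10_ii.{u₁, u₂, u₃, u₄, u₅, u₆, u₇, u₈} -- IUTchII:Cor4.10(ii) · DAGL6s
  ∧ N_IUTchII_Cor4_10_iii.{u₁, u₂, u₃, u₄, u₅, u₆, u₇, u₈} -- IUTchII:Cor4.10(iii) · DAGL6d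
  ∧ N_IUTchII_Cor4_10_vi -- IUTchII:Cor4.10(vi) · DAGL6b
  ∧ N_IUTchII_Cor4_11_i.{u₁, u₂, u₃, u₄, u₅, u₆, u₇, u₈} -- IUTchII:Cor4.11(i) · DAGL6b
  ∧ N_IUTchII_Cor4_11_ii -- IUTchII:Cor4.11(ii) · DAGL6b
  ∧ N_IUTchII_Cor4_11_iii.{u₁, u₂, u₃, u₄, u₅, u₆, u₇} -- IUTchII:Cor4.11(iii) · DAGL6s
  ∧ N_IUTchII_Cor4_5_iii.{u₁, u₂, u₃} -- IUTchII:Cor4.5(iii) · DAGL6r · NODES-discharged since v3.4ag (p414022); kernel witness in `layer6DischargedA_v3_4ag_holds`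
  ∧ N_IUTchII_Cor4_5_iv.{u₁, u₂} -- IUTchII:Cor4.5(iv) · DAGL6s
  ∧ N_IUTchII_Cor4_5_v.{u₁, u₂, u₃} -- IUTchII:Cor4.5(v) · DAGL6s
  ∧ N_IUTchII_Prop1_2_i.{u₁} -- IUTchII:Prop1.2(i) · DAGL6p · NODES-discharged since v3.4ag (p406189); kernel witness in `layer6DischargedA_v3_4ag_holds`
  ∧ N_IUTchII_Prop1_2_ii.{u₁, u₂} -- IUTchII:Prop1.2(ii) · DAGL6p · NODES-discharged since v3.4ag (p406189); kernel witness in `layer6DischargedA_v3_4ag_holds`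
  ∧ N_IUTchII_Prop1_3_i.{u₁, u₂} -- IUTchII:Prop1.3(i) · DAGL6p
  ∧ N_IUTchII_Prop1_3_iii.{u₁, u₂} -- IUTchII:Prop1.3(iii) · DAGL6p
  ∧ N_IUTchII_Prop1_4.{u₁} -- IUTchII:Prop1.4 · DAGL6p · NODES-discharged since v3.4ag (p406189); kernel witness in `layer6DischargedA_v3_4ag_holds`
  ∧ N_IUTchII_Prop1_5_i.{u₁} -- IUTchII:Prop1.5(i) · DAGL6p · NODES-discharged since v3.4ag (p407497); kernel witness in `layer6DischargedA_v3_4ag_holds`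
  ∧ N_IUTchII_Prop2_1.{u₁} -- IUTchII:Prop2.1 · DAGL6q
  ∧ N_IUTchII_Prop2_2_i.{u₁} -- IUTchII:Prop2.2(i) · DAGL6q
  ∧ N_IUTchII_Prop2_2_ii.{u₁} -- IUTchII:Prop2.2(ii) · DAGL6q
  ∧ N_IUTchII_Prop3_1_i.{u₁, u₂} -- IUTchII:Prop3.1(i) · DAGL6r
  ∧ N_IUTchII_Prop3_1_ii.{u₁} -- IUTchII:Prop3.1(ii) · DAGL6r
  ∧ N_IUTchII_Prop3_3_i.{u₁, u₂} -- IUTchII:Prop3.3(i) · DAGL6r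
  ∧ N_IUTchII_Prop3_4_i.{u₁, u₂} -- IUTchII:Prop3.4(i) · DAGL6r
  ∧ N_IUTchII_Prop3_4_ii.{u₁, u₂, u₃} -- IUTchII:Prop3.4(ii) · DAGL6r
  ∧ N_IUTchII_Prop4_1_iii.{u₁, u₂} -- IUTchII:Prop4.1(iii) · DAGL6d

/-- The [IUTchII] slice of the L6 cone: discharged ∧ residual (packaging of record). [claim: Mochizuki2012, status: disputed] -/
def Layer6ConeA : Prop :=
  Layer6DischargedA.{u₁, u₂, u₃, u₄, u₅, u₆, u₇, u₈} ∧ Layer6ResidualA.{u₁, u₂, u₃, u₄, u₅, u₆, u₇, u₈}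

/-- The slice follows from its residual alone (the discharged half is witnessed BY NAME). [claim: Mochizuki2012, status: disputed] -/
theorem layer6ConeA_of (h : Layer6ResidualA.{u₁, u₂, u₃, u₄, u₅, u₆, u₇, u₈}) :
    Layer6ConeA.{u₁, u₂, u₃, u₄, u₅, u₆, u₇, u₈} :=
  ⟨layer6DischargedA_holds.{u₁, u₂, u₃, u₄, u₅, u₆, u₇, u₈}, h⟩

/-- **FOLD v3.4ae** — kernel witnesses BY NAME of the rows that became NODES-discharged at NODES v3.4ae and whose conjuncts are not inside the
frozen `Layer6DischargedA`: Cor1.11, Cor4.5(ii), Cor4.5(iii), Cor4.6(iv), Prop1.2(i), Prop1.5(i) (10 conjuncts: index Props / closed sub-rows). Appended, never mutated.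
[claim: Mochizuki2012, status: disputed] -/
theorem layer6DischargedA_v3_4ae_holds :
    N_IUTchII_Cor1_11.{u₁}
    ∧ N_IUTchII_Cor1_11_0_r1.{u₁}
    ∧ N_IUTchII_Cor1_11_b_r6
    ∧ N_IUTchII_Cor1_11_b_r7.{u₁}
    ∧ N_IUTchII_Cor1_11_R_r13.{u₁}
    ∧ N_IUTchII_Cor4_5_ii_r5.{u₁, u₂, u₃}
    ∧ N_IUTchII_Cor4_5_iii.{u₁, u₂, u₃}
    ∧ N_IUTchII_Cor4_6_iv_r13.{u₁, u₂, u₃, u₄, u₅}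
    ∧ N_IUTchII_Prop1_2_i.{u₁}
    ∧ N_IUTchII_Prop1_5_i.{u₁} :=
  ⟨N_IUTchII_Cor1_11_part, N_IUTchII_Cor1_11_0_r1_holds, N_IUTchII_Cor1_11_b_r6_holds,
    N_IUTchII_Cor1_11_b_r7_holds, N_IUTchII_Cor1_11_R_r13_holds, N_IUTchII_Cor4_5_ii_r5_holds,
    N_IUTchII_Cor4_5_iii_part, N_IUTchII_Cor4_6_iv_r13_holds, N_IUTchII_Prop1_2_i_part,
    N_IUTchII_Prop1_5_i_part⟩

/-- **FOLD v3.4af** — kernel witnesses BY NAME of the rows that became NODES-discharged at NODES v3.4af and whose conjuncts are not inside the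
frozen `Layer6DischargedA`: Cor1.12(i), Prop1.4 (3 conjuncts: index Props / closed sub-rows). Appended, never mutated.
[claim: Mochizuki2012, status: disputed] -/
theorem layer6DischargedA_v3_4af_holds :
    N_IUTchII_Cor1_12_i.{u₁}
    ∧ N_IUTchII_Cor1_12_i_r12.{u₁}
    ∧ N_IUTchII_Prop1_4.{u₁} :=
  ⟨N_IUTchII_Cor1_12_i_part, N_IUTchII_Cor1_12_i_r12_holds, N_IUTchII_Prop1_4_part⟩

/-- **FOLD v3.4ag** — kernel witnesses BY NAME of the rows that became NODES-discharged at NODES v3.4ag and whose conjuncts are not inside the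
frozen `Layer6DischargedA`: Prop1.2(ii) (1 conjuncts: index Props / closed sub-rows). Appended, never mutated.
[claim: Mochizuki2012, status: disputed] -/
theorem layer6DischargedA_v3_4ag_holds :
    N_IUTchII_Prop1_2_ii.{u₁, u₂} :=
  N_IUTchII_Prop1_2_ii_part

/-! ### d_data and f rows — NAME-CHECKED ONLY (the build breaks if an index name drifts; no Prop is asserted) -/
example := @N_IUTchII_Cor2_5_iii -- IUTchII:Cor2.5(iii) [Data(listed) @ v3.4ag]
example := @N_IUTchII_Cor2_6_i.{u₁} -- IUTchII:Cor2.6(i) [Data(listed) @ v3.4ag]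
example := @N_IUTchII_Cor4_10_v.{u₁, u₂, u₃, u₄, u₅, u₆, u₇, u₈} -- IUTchII:Cor4.10(v) [Data(listed) @ v3.4ag]
example := @N_IUTchII_Cor4_5_i -- IUTchII:Cor4.5(i) [Data(listed) @ v3.4ag]
example := @N_IUTchII_Cor4_5_ii -- IUTchII:Cor4.5(ii) [Discharged @ v3.4ag]
example := @N_IUTchII_Cor4_6_i -- IUTchII:Cor4.6(i) [Data(listed) @ v3.4ag]
example := @N_IUTchII_Cor4_6_iv -- IUTchII:Cor4.6(iv) [Discharged @ v3.4ag]
example := @N_IUTchII_Cor4_7_i -- IUTchII:Cor4.7(i) [Data(listed) @ v3.4ag]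
example := @N_IUTchII_Cor4_7_ii -- IUTchII:Cor4.7(ii) [Data(listed) @ v3.4ag]
example := @N_IUTchII_Cor4_7_iii -- IUTchII:Cor4.7(iii) [Data(listed) @ v3.4ag]
example := @N_IUTchII_Cor4_8_i -- IUTchII:Cor4.8(i) [Data(listed) @ v3.4ag]
example := @N_IUTchII_Cor4_8_ii -- IUTchII:Cor4.8(ii) [Data(listed) @ v3.4ag]
example := @N_IUTchII_Cor4_8_iii -- IUTchII:Cor4.8(iii) [Data(listed) @ v3.4ag]
example := @N_IUTchII_Def2_7_i.{u₁, u₂} -- IUTchII:Def2.7(i) [Data(listed) @ v3.4ag]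
example := @N_IUTchII_Ex1_7_i -- IUTchII:Ex1.7(i) [Data(listed) @ v3.4ag]
example := @N_IUTchII_Ex1_8_iv.{u₁} -- IUTchII:Ex1.8(iv) [Data(listed) @ v3.4ag]
example := @N_IUTchII_Ex1_8_ix.{u₁} -- IUTchII:Ex1.8(ix) [Data(listed) @ v3.4ag]
example := @N_IUTchII_Ex1_8_v.{u₁, u₂} -- IUTchII:Ex1.8(v) [Data(listed) @ v3.4ag]
example := @N_IUTchII_Ex1_8_vi.{u₁, u₂} -- IUTchII:Ex1.8(vi) [Data(listed) @ v3.4ag]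
example := @N_IUTchII_Ex1_8_vii.{u₁} -- IUTchII:Ex1.8(vii) [Data(listed) @ v3.4ag]
example := @N_IUTchII_Ex1_8_viii.{u₁, u₂} -- IUTchII:Ex1.8(viii) [Data(listed) @ v3.4ag]
example := @N_IUTchII_Ex3_2_ii.{u₁, u₂} -- IUTchII:Ex3.2(ii) [Data(listed) @ v3.4ag]
example := @N_IUTchII_Prop3_3_ii -- IUTchII:Prop3.3(ii) [Data(listed) @ v3.4ag]
example := @N_IUTchII_Prop4_1_i.{u₁} -- IUTchII:Prop4.1(i) [Data(listed) @ v3.4ag]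
example := @N_IUTchII_Prop4_1_ii -- IUTchII:Prop4.1(ii) [Data(listed) @ v3.4ag]
example := @N_IUTchII_Prop4_2_i -- IUTchII:Prop4.2(i) [Data(listed) @ v3.4ag]
example := @N_IUTchII_Prop4_3_i.{u₁} -- IUTchII:Prop4.3(i) [Data(listed) @ v3.4ag]
example := @N_IUTchII_Prop4_3_iii.{u₁, u₂} -- IUTchII:Prop4.3(iii) [Data(listed) @ v3.4ag]
example := @N_IUTchII_Prop4_4_i -- IUTchII:Prop4.4(i) [Data(listed) @ v3.4ag]
example := @N_IUTchII_Prop4_4_ii -- IUTchII:Prop4.4(ii) [Data(listed) @ v3.4ag]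
example := @N_IUTchII_Prop4_4_iii -- IUTchII:Prop4.4(iii) [Data(listed) @ v3.4ag]
example := @N_IUTchII_Prop4_4_iv -- IUTchII:Prop4.4(iv) [Data(listed) @ v3.4ag]
example := @N_IUTchII_Cor3_5_i -- IUTchII:Cor3.5(i) [Discharged @ v3.4ag]
example := @N_IUTchII_Cor3_6_i.{u₁, u₂, u₃} -- IUTchII:Cor3.6(i) [Discharged @ v3.4ag]
example := @N_IUTchII_Cor4_6_v -- IUTchII:Cor4.6(v) [Discharged @ v3.4ag]
example := @N_IUTchII_Prop1_5_iii.{u₁} -- IUTchII:Prop1.5(iii) [Discharged @ v3.4ag]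
example := @N_IUTchII_Cor2_8_ii.{u₁, u₂} -- IUTchII:Cor2.8(ii) [Flagged(K3-schema) @ v3.4ag]
example := @N_IUTchII_Cor2_8_iii.{u₁} -- IUTchII:Cor2.8(iii) [Flagged(K3-schema) @ v3.4ag]
example := @N_IUTchII_Prop1_5_iv.{u₁} -- IUTchII:Prop1.5(iv) [Flagged(K3-schema) @ v3.4ag]

end Summit.ABC.IUTFork.Conditional

end
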